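import Summits.AnomalousDissipation.AnomalousDissipation.Theorems.SawtoothPulseCascadeK3LocalisedClosureApproxWindow
import HarnessLib

/-!
# K3loc / ApproxSol58, line `DriftFree` — helper: `ApproximateSolution` from two SCALAR ENVELOPES of the
# linearised response (an `L²` envelope `E` and a Lipschitz envelope `Λ`)

Helper file of the lead prover (gen 3) for the crux `K3LocalisedClosure` (stmt-AnomalousDissipation-19492) and its
open child `ApproxSol58` (stmt-AnomalousDissipation-19688 = the registered stub `stub_approximateSolution` of the line
`DriftFree`: `K2LinearisedCascadeGrowth → ∀ box, DriftFree.ApproximateSolution ⟨γ, 1/4, 2, 1, ρN⟩ (γ² − 3)`).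

The landed reductions `approximateSolution_of_linearisedResponse` / `approximateSolution_of_window` (gen 0) leave
three estimates on the classical linearised response `L` (Grenier's witness `U = ū + L`): a pointwise strain bound
`Λ_L`, `∫₀ᵀ‖L‖² ≤ εν`, and the Duhamel–Grönwall smallness of the VECTOR defect `(L·∇)L`.  This file removes the
last pieces of vector calculus from that interface (`approximateSolution_of_envelopes`): it suffices to produce, on
the window `[0, T]`, `T = horizon r ν A`, two continuous SCALAR envelopes

* `E(t) ≥ ‖L(t)‖_{L²}` — the quantity the crux `K2″` (`K2PhaseGrowthClassical`, an `L² → L²` cap per phase for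
  comb-class data) controls after the realignment bookkeeping, and
* `Λ(t) ≥ sup_x ‖DL(t,x)‖` (operator norm of the space derivative `Torus.fderiv`) — the LIPSCHITZ size of the
  response, which `K2″` does NOT control (lead census gen 2/3: this is the one input of `ApproxSol58` that needs a
  hypothesis of its own, the per-phase Lipschitz cap measured by the cell's TEST E),

with `∫₀ᵀ E² ≤ εν` and `(∫₀ᵗ e^{∫ₛᵗ(½Σrate + Λ)} Λ(s)E(s) ds)² ≤ εν` for `t ≤ T` — because pointwise
`⟪ξ,(ξ·∇)L⟫ ≤ ‖DL‖‖ξ‖²` (§C1, the strain is below the Lipschitz size) and `‖(L·∇)L‖_{L²} ≤ sup‖DL‖ · ‖L‖_{L²}`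
(§C1, `(L·∇)L(x) = DL(x)[L(x)]`), and the Duhamel–Grönwall functional is monotone in the defect (§C2).  What is then
left of `ApproxSol58` is: the classical linearised response on closed windows (tree: `Torus.linearisedNSForced_exists`),
its `L²` envelope from `K2″`, its Lipschitz envelope (new hypothesis), and real-variable bookkeeping of the two scalar
inequalities.
-/

-- `Summit.<Summit>.<Problem>`: single-conjunct summit, the duplicate namespace segment is deliberate.
set_option linter.dupNamespace false

noncomputable section

namespace Summit.AnomalousDissipation.AnomalousDissipation.Theorems.SawtoothPulseCascade.DriftFreeApprox

open scoped InnerProductSpace NNReal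
open MeasureTheory Set Filter Topology
open Literature.Analysis Literature.Analysis.FunctionSpaces Literature.Analysis.FluidPDE
open Literature.Analysis.FluidPDE.SawtoothCascade
open Literature.Analysis.FluidPDE.SawtoothCascade.DriftFree

/-! ## §C1 Pointwise bridges from the Lipschitz size `‖DL(x)‖` -/

section Pointwise

variable (v : UnitAddTorus (Fin 2) → EuclideanSpace ℝ (Fin 2))

/-- The one-sided strain is below the Lipschitz size: `⟪ξ, (ξ·∇)v(x)⟫ ≤ ‖Dv(x)‖ ‖ξ‖²` (Cauchy–Schwarz and the
operator norm; `(ξ·∇)v(x) = Dv(x)[ξ]`). [folklore] -/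
theorem inner_convect_const_le_opNorm (x : UnitAddTorus (Fin 2)) (ξ : EuclideanSpace ℝ (Fin 2)) :
    ⟪ξ, FunctionSpaces.Torus.convect (fun _ => ξ) v x⟫_ℝ ≤ ‖FunctionSpaces.Torus.fderiv v x‖ * ‖ξ‖ ^ 2 := by
  have h1 : ⟪ξ, FunctionSpaces.Torus.convect (fun _ => ξ) v x⟫_ℝ ≤ ‖ξ‖ * ‖FunctionSpaces.Torus.fderiv v x ξ‖ :=
    real_inner_le_norm _ _
  have h2 : ‖FunctionSpaces.Torus.fderiv v x ξ‖ ≤ ‖FunctionSpaces.Torus.fderiv v x‖ * ‖ξ‖ :=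
    ContinuousLinearMap.le_opNorm _ _
  calc ⟪ξ, FunctionSpaces.Torus.convect (fun _ => ξ) v x⟫_ℝ ≤ ‖ξ‖ * ‖FunctionSpaces.Torus.fderiv v x ξ‖ := h1
    _ ≤ ‖ξ‖ * (‖FunctionSpaces.Torus.fderiv v x‖ * ‖ξ‖) := mul_le_mul_of_nonneg_left h2 (norm_nonneg _)
    _ = ‖FunctionSpaces.Torus.fderiv v x‖ * ‖ξ‖ ^ 2 := by ring

/-- A Lipschitz bound `‖Dv(x)‖ ≤ Λ` is a strain bound `⟪ξ, (ξ·∇)v(x)⟫ ≤ Λ‖ξ‖²` (the hypothesis `StrainBoundedBy`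
of Grenier's remainder step, slice by slice). [folklore] -/
theorem inner_convect_const_le_of_opNorm_le {Λ : ℝ} {x : UnitAddTorus (Fin 2)}
    (h : ‖FunctionSpaces.Torus.fderiv v x‖ ≤ Λ) (ξ : EuclideanSpace ℝ (Fin 2)) :
    ⟪ξ, FunctionSpaces.Torus.convect (fun _ => ξ) v x⟫_ℝ ≤ Λ * ‖ξ‖ ^ 2 :=
  (inner_convect_const_le_opNorm v x ξ).trans (mul_le_mul_of_nonneg_right h (sq_nonneg _))

/-- Self-advection is below Lipschitz size times amplitude: `‖(v·∇)v(x)‖ ≤ ‖Dv(x)‖ ‖v(x)‖`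
(`(v·∇)v(x) = Dv(x)[v(x)]`). [folklore] -/
theorem norm_convect_self_le (x : UnitAddTorus (Fin 2)) :
    ‖FunctionSpaces.Torus.convect v v x‖ ≤ ‖FunctionSpaces.Torus.fderiv v x‖ * ‖v x‖ :=
  ContinuousLinearMap.le_opNorm _ _

variable {v}

/-- `L²` size of the self-advection: `‖(v·∇)v‖²_{L²} ≤ Λ² ‖v‖²_{L²}` when `‖Dv‖ ≤ Λ` everywhere (for continuous
`v` with continuous `(v·∇)v`, e.g. a smooth slice). [folklore] -/
theorem vectorL2Sq_convect_self_le (hv : Continuous v)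
    (hc : Continuous fun x => FunctionSpaces.Torus.convect v v x) {Λ : ℝ}
    (hΛ : ∀ x, ‖FunctionSpaces.Torus.fderiv v x‖ ≤ Λ) :
    FluidPDE.Torus.vectorL2Sq (fun x => FunctionSpaces.Torus.convect v v x) ≤
      Λ ^ 2 * FluidPDE.Torus.vectorL2Sq v := by
  have hpt : ∀ x, ‖FunctionSpaces.Torus.convect v v x‖ ^ 2 ≤ Λ ^ 2 * ‖v x‖ ^ 2 := by
    intro x
    have h1 : ‖FunctionSpaces.Torus.convect v v x‖ ≤ Λ * ‖v x‖ :=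
      (norm_convect_self_le v x).trans (mul_le_mul_of_nonneg_right (hΛ x) (norm_nonneg _))
    calc ‖FunctionSpaces.Torus.convect v v x‖ ^ 2 ≤ (Λ * ‖v x‖) ^ 2 := pow_le_pow_left₀ (norm_nonneg _) h1 2
      _ = Λ ^ 2 * ‖v x‖ ^ 2 := by ring
  have c1 : Continuous fun x => ‖FunctionSpaces.Torus.convect v v x‖ ^ 2 := by fun_prop
  have c2 : Continuous fun x => Λ ^ 2 * ‖v x‖ ^ 2 := by fun_prop
  calc FluidPDE.Torus.vectorL2Sq (fun x => FunctionSpaces.Torus.convect v v x)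
      = ∫ x, ‖FunctionSpaces.Torus.convect v v x‖ ^ 2 := rfl
    _ ≤ ∫ x, Λ ^ 2 * ‖v x‖ ^ 2 := integral_mono c1.integrable_unitAddTorus c2.integrable_unitAddTorus hpt
    _ = Λ ^ 2 * FluidPDE.Torus.vectorL2Sq v := by
        rw [integral_const_mul]; rfl

/-- The same in `L²`-norm form: `‖(v·∇)v‖_{L²} ≤ Λ ‖v‖_{L²}` (`0 ≤ Λ`). [folklore] -/
theorem sqrt_vectorL2Sq_convect_self_le (hv : Continuous v)
    (hc : Continuous fun x => FunctionSpaces.Torus.convect v v x) {Λ : ℝ} (hΛ0 : 0 ≤ Λ)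
    (hΛ : ∀ x, ‖FunctionSpaces.Torus.fderiv v x‖ ≤ Λ) :
    Real.sqrt (FluidPDE.Torus.vectorL2Sq (fun x => FunctionSpaces.Torus.convect v v x)) ≤
      Λ * Real.sqrt (FluidPDE.Torus.vectorL2Sq v) := by
  calc Real.sqrt (FluidPDE.Torus.vectorL2Sq (fun x => FunctionSpaces.Torus.convect v v x))
      ≤ Real.sqrt (Λ ^ 2 * FluidPDE.Torus.vectorL2Sq v) := Real.sqrt_le_sqrt (vectorL2Sq_convect_self_le hv hc hΛ)
    _ = Λ * Real.sqrt (FluidPDE.Torus.vectorL2Sq v) := by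
        rw [Real.sqrt_mul (sq_nonneg Λ), Real.sqrt_sq hΛ0]

end Pointwise

/-! ## §C2 The Duhamel–Grönwall functional: continuity of the weight, monotonicity in the defect -/

section Duhamel

/-- The weight exponent `s ↦ ∫ₛᵗ n` is continuous on `[a, t]` for `n` continuous there. [folklore] -/
theorem continuousOn_integral_left {n : ℝ → ℝ} {a t : ℝ} (hn : ContinuousOn n (Icc a t)) (hat : a ≤ t) :
    ContinuousOn (fun s => ∫ τ in s..t, n τ) (Icc a t) := by
  have hint : IntervalIntegrable n volume a t := by
    refine ContinuousOn.intervalIntegrable ?_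
    rw [uIcc_of_le hat]; exact hn
  have h := intervalIntegral.continuousOn_primitive_interval' hint (right_mem_uIcc (a := a) (b := t))
  rw [uIcc_of_le hat] at h
  refine h.neg.congr fun s _ => ?_
  simp only [Pi.neg_apply, intervalIntegral.integral_symm t s]

variable {Λw B : ℝ → ℝ} {ρ : ℝ → UnitAddTorus (Fin 2) → EuclideanSpace ℝ (Fin 2)} {T t : ℝ}

/-- **The Duhamel–Grönwall defect functional is monotone in the defect**: if `‖ρ(s)‖_{L²} ≤ B(s)` on `[0, t]`
(everything continuous on `[0, T] ∋ t`), then `∫₀ᵗ e^{∫ₛᵗ Λ⁺} ‖ρ(s)‖ ds ≤ ∫₀ᵗ e^{∫ₛᵗ Λ⁺} B(s) ds`. [folklore] -/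
theorem duhamelDefect_le_integral (ht : t ∈ Icc 0 T) (hΛw : ContinuousOn Λw (Icc 0 T))
    (hρ : ContinuousOn (fun s => Real.sqrt (FluidPDE.Torus.vectorL2Sq (ρ s))) (Icc 0 T))
    (hB : ContinuousOn B (Icc 0 T))
    (hle : ∀ s ∈ Icc 0 t, Real.sqrt (FluidPDE.Torus.vectorL2Sq (ρ s)) ≤ B s) :
    duhamelDefect Λw ρ t ≤ ∫ s in (0 : ℝ)..t, Real.exp (∫ τ in s..t, max (Λw τ) 0) * B s := by
  have h0t : (0 : ℝ) ≤ t := ht.1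
  have hsub : Icc 0 t ⊆ Icc 0 T := Icc_subset_Icc le_rfl ht.2
  have hut : uIcc 0 t = Icc 0 t := uIcc_of_le h0t
  have hm : ContinuousOn (fun τ => max (Λw τ) 0) (Icc 0 t) := (hΛw.mono hsub).sup continuousOn_const
  have hE : ContinuousOn (fun s => Real.exp (∫ τ in s..t, max (Λw τ) 0)) (Icc 0 t) :=
    Real.continuous_exp.comp_continuousOn (continuousOn_integral_left hm h0t)
  have hf : IntervalIntegrable (fun s => Real.exp (∫ τ in s..t, max (Λw τ) 0) *
      Real.sqrt (FluidPDE.Torus.vectorL2Sq (ρ s))) volume 0 t := by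
    refine ContinuousOn.intervalIntegrable ?_
    rw [hut]; exact hE.mul (hρ.mono hsub)
  have hg : IntervalIntegrable (fun s => Real.exp (∫ τ in s..t, max (Λw τ) 0) * B s) volume 0 t := by
    refine ContinuousOn.intervalIntegrable ?_
    rw [hut]; exact hE.mul (hB.mono hsub)
  unfold duhamelDefect
  exact intervalIntegral.integral_mono_on h0t hf hg fun s hs =>
    mul_le_mul_of_nonneg_left (hle s hs) (Real.exp_pos _).le

/-- For a non-negative rate the positive part in the weight is idle: `∫₀ᵗ e^{∫ₛᵗ n⁺} B = ∫₀ᵗ e^{∫ₛᵗ n} B`.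
[folklore] -/
theorem integral_exp_max_eq_of_nonneg {n : ℝ → ℝ} (h0t : 0 ≤ t) (hn : ∀ τ ∈ Icc 0 t, 0 ≤ n τ) (B : ℝ → ℝ) :
    (∫ s in (0 : ℝ)..t, Real.exp (∫ τ in s..t, max (n τ) 0) * B s) =
      ∫ s in (0 : ℝ)..t, Real.exp (∫ τ in s..t, n τ) * B s := by
  refine intervalIntegral.integral_congr fun s hs => ?_
  have hs' : s ∈ Icc 0 t := by rwa [uIcc_of_le h0t] at hs
  have hin : (∫ τ in s..t, max (n τ) 0) = ∫ τ in s..t, n τ :=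
    intervalIntegral.integral_congr fun τ hτ => by
      have hτ' : τ ∈ Icc s t := by rwa [uIcc_of_le hs'.2] at hτ
      exact max_eq_left (hn τ ⟨hs'.1.trans hτ'.1, hτ'.2⟩)
  simp only [hin]

end Duhamel

/-! ## §C3 `ApproximateSolution` from the two scalar envelopes -/

/-- **`ApproximateSolution P r` from an `L²` envelope and a Lipschitz envelope of the linearised response.**  For every
lag `A` and `ε > 0`, for all small `ν`, suppose there are `T' ∈ (T, 1)`, `T = horizon r ν A`, a classical solution `L`
(pressure `q`) on `[0, T'] × 𝕋²` of the Navier–Stokes equations linearised at the cascade carrier with the heat-lag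
source `νΔū` from rest (`∂ₜL + (ū·∇)L + (L·∇)ū = νΔL − ∇q + νΔū`, `div L = 0`, `L(0) = 0`; the tree's
`Torus.linearisedNSForced_exists` provides it), and two continuous envelopes on `[0, T]`: `‖L(t)‖_{L²} ≤ E(t)` and
`‖DL(t,x)‖ ≤ Λ(t)` for all `x`, with the two SCALAR inequalities `∫₀ᵀ E² ≤ εν` and
`(∫₀ᵗ e^{∫ₛᵗ(½Σⱼ(rateH j + rateV j) + Λ)} Λ(s) E(s) ds)² ≤ εν` for `t ≤ T`.  Then `ApproximateSolution P r` (via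
`approximateSolution_of_window`: the strain of `L` is `≤ Λ`, the defect `(L·∇)L` has `L²` norm `≤ ΛE`, and the
Duhamel–Grönwall functional is monotone).  Intended use: `E` from the crux `K2″` (after realignment), `Λ` from a
per-phase Lipschitz cap of the linearised cascade response. [folklore] -/
theorem approximateSolution_of_envelopes (P : CascadeParams) (hγ : 0 ≤ P.γ) (hδ₀ : 0 < P.δ₀) (hd : 0 < P.d)
    {r : ℝ}
    (h : ∀ A : ℕ, ∀ ε : ℝ, 0 < ε → ∃ ν₀ : ℝ, 0 < ν₀ ∧ ∀ ν ∈ Ioc 0 ν₀, ∃ T' : ℝ,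
      horizon r ν A < T' ∧ T' < 1 ∧
      ∃ (L : ℝ → UnitAddTorus (Fin 2) → EuclideanSpace ℝ (Fin 2)) (q : ℝ → UnitAddTorus (Fin 2) → ℝ)
        (E Λ : ℝ → ℝ),
        FunctionSpaces.Torus.IsSmoothSpaceTimeOn (Icc 0 T') L ∧
        FunctionSpaces.Torus.IsSmoothSpaceTimeOn (Icc 0 T') q ∧
        (∀ t ∈ Icc 0 T', FunctionSpaces.Torus.IsDivFree (L t)) ∧ L 0 = 0 ∧
        (∀ t ∈ Icc 0 T', ∀ x,
          FunctionSpaces.Torus.timeDerivWithin (Icc 0 T') L t x +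
              FunctionSpaces.Torus.convect (P.field t) (L t) x + FunctionSpaces.Torus.convect (L t) (P.field t) x =
            ν • FunctionSpaces.Torus.laplacian (L t) x - FunctionSpaces.Torus.gradient (q t) x +
              ν • FunctionSpaces.Torus.laplacian (P.field t) x) ∧
        (∀ t ∈ Icc 0 (horizon r ν A), Real.sqrt (FluidPDE.Torus.vectorL2Sq (L t)) ≤ E t) ∧
        (∀ t ∈ Icc 0 (horizon r ν A), ∀ x : UnitAddTorus (Fin 2), ‖FunctionSpaces.Torus.fderiv (L t) x‖ ≤ Λ t) ∧
        ContinuousOn E (Icc 0 (horizon r ν A)) ∧ ContinuousOn Λ (Icc 0 (horizon r ν A)) ∧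
        (∫ s in (0 : ℝ)..horizon r ν A, E s ^ 2) ≤ ε * ν ∧
        ∀ t ∈ Icc 0 (horizon r ν A),
          (∫ s in (0 : ℝ)..t, Real.exp (∫ τ in s..t, ((∑' j, (P.rateH j τ + P.rateV j τ)) / 2 + Λ τ)) *
              (Λ s * E s)) ^ 2 ≤ ε * ν) :
    ApproximateSolution P r := by
  refine approximateSolution_of_window P hγ hδ₀ hd fun A ε hε => ?_
  obtain ⟨ν₀, hν₀, hν⟩ := h A ε hε
  refine ⟨ν₀, hν₀, fun ν hνm => ?_⟩
  obtain ⟨T', hTT', hT'1, L, q, E, Λ, hL, hq, hdiv, hL0, hlin, hE, hΛ, hEc, hΛc, hint, hdef⟩ := hν ν hνm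
  set T := horizon r ν A with hT
  have hT0 : 0 ≤ T := CascadeParams.tStart_nonneg _
  have hTT'le : Icc 0 T ⊆ Icc 0 T' := Icc_subset_Icc le_rfl hTT'.le
  -- non-negativity of the envelopes and of the carrier rate
  have hΛ0 : ∀ t ∈ Icc 0 T, 0 ≤ Λ t := fun t ht => (norm_nonneg _).trans (hΛ t ht 0)
  have hE0 : ∀ t ∈ Icc 0 T, 0 ≤ E t := fun t ht => (Real.sqrt_nonneg _).trans (hE t ht)
  have hrate0 : ∀ τ, 0 ≤ (∑' j, (P.rateH j τ + P.rateV j τ)) / 2 := fun τ =>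
    div_nonneg (tsum_nonneg fun j => add_nonneg (P.rateH_nonneg hγ j τ) (P.rateV_nonneg hγ j τ)) zero_le_two
  -- the defect `(L·∇)L` and its `L²` norm
  have hρs : FunctionSpaces.Torus.IsSmoothSpaceTimeOn (Icc 0 T')
      (fun s x => FunctionSpaces.Torus.convect (L s) (L s) x) :=
    hL.convect hL (uniqueDiffOn_Icc (hT0.trans_lt hTT'))
  have hρc : ContinuousOn (fun s => Real.sqrt (FluidPDE.Torus.vectorL2Sq
      (fun x => FunctionSpaces.Torus.convect (L s) (L s) x))) (Icc 0 T) :=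
    (Real.continuous_sqrt.comp_continuousOn
      ((hρs.continuousOn_integral_norm_sq (convex_Icc 0 T')).mono hTT'le)).congr fun s _ => rfl
  have hρle : ∀ s ∈ Icc 0 T, Real.sqrt (FluidPDE.Torus.vectorL2Sq
      (fun x => FunctionSpaces.Torus.convect (L s) (L s) x)) ≤ Λ s * E s := by
    intro s hs
    have hLs : FunctionSpaces.Torus.IsSmooth (L s) := hL.isSmooth_slice (hTT'le hs)
    have hcs : Continuous fun x => FunctionSpaces.Torus.convect (L s) (L s) x :=
      (hρs.isSmooth_slice (hTT'le hs)).continuous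
    exact (sqrt_vectorL2Sq_convect_self_le hLs.continuous hcs (hΛ0 s hs) (hΛ s hs)).trans
      (mul_le_mul_of_nonneg_left (hE s hs) (hΛ0 s hs))
  refine ⟨T', hTT', hT'1, L, q, Λ, hL, hq, hdiv, hL0, hlin,
    fun t ht x ξ => inner_convect_const_le_of_opNorm_le (L t) (hΛ t ht x) ξ, hΛc, ?_, ?_⟩
  · -- `∫₀ᵀ ‖L‖² ≤ ∫₀ᵀ E² ≤ εν`
    have hut : uIcc 0 T = Icc 0 T := uIcc_of_le hT0
    have hLc : ContinuousOn (fun s => FluidPDE.Torus.vectorL2Sq (L s)) (Icc 0 T) :=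
      ((hL.continuousOn_integral_norm_sq (convex_Icc 0 T')).mono hTT'le).congr fun s _ => rfl
    have i1 : IntervalIntegrable (fun s => FluidPDE.Torus.vectorL2Sq (L s)) volume 0 T := by
      refine ContinuousOn.intervalIntegrable ?_; rw [hut]; exact hLc
    have i2 : IntervalIntegrable (fun s => E s ^ 2) volume 0 T := by
      refine ContinuousOn.intervalIntegrable ?_; rw [hut]; exact hEc.pow 2
    have hle : ∀ s ∈ Icc 0 T, FluidPDE.Torus.vectorL2Sq (L s) ≤ E s ^ 2 := by
      intro s hs
      have h0 : 0 ≤ FluidPDE.Torus.vectorL2Sq (L s) := integral_nonneg fun _ => sq_nonneg _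
      calc FluidPDE.Torus.vectorL2Sq (L s) = Real.sqrt (FluidPDE.Torus.vectorL2Sq (L s)) ^ 2 :=
            (Real.sq_sqrt h0).symm
        _ ≤ E s ^ 2 := pow_le_pow_left₀ (Real.sqrt_nonneg _) (hE s hs) 2
    exact (intervalIntegral.integral_mono_on hT0 i1 i2 hle).trans hint
  · -- the Duhamel–Grönwall functional of `(L·∇)L` against `½Σrate + Λ` is below `∫₀ᵗ e^{∫ₛᵗ(½Σrate+Λ)} ΛE`
    intro t ht
    have hTlt1 : T < 1 := hTT'.trans hT'1
    have hmc : ContinuousOn (fun s => (∑' j, (P.rateH j s + P.rateV j s)) / 2 + Λ s) (Icc 0 T) :=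
      (continuousOn_rate_sum P hTlt1).add hΛc
    have hBc : ContinuousOn (fun s => Λ s * E s) (Icc 0 T) := hΛc.mul hEc
    have h1 := duhamelDefect_le_integral ht hmc hρc hBc fun s hs => hρle s ⟨hs.1, hs.2.trans ht.2⟩
    rw [integral_exp_max_eq_of_nonneg ht.1
      (fun τ hτ => add_nonneg (hrate0 τ) (hΛ0 τ ⟨hτ.1, hτ.2.trans ht.2⟩)) (fun s => Λ s * E s)] at h1
    have h0 : 0 ≤ duhamelDefect (fun s => (∑' j, (P.rateH j s + P.rateV j s)) / 2 + Λ s)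
        (fun s x => FunctionSpaces.Torus.convect (L s) (L s) x) t :=
      intervalIntegral.integral_nonneg ht.1 fun s _ => mul_nonneg (Real.exp_pos _).le (Real.sqrt_nonneg _)
    exact (pow_le_pow_left₀ h0 h1 2).trans (hdef t ht)

end Summit.AnomalousDissipation.AnomalousDissipation.Theorems.SawtoothPulseCascade.DriftFreeApprox

end
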